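import Mathlib
import HarnessLib
import Summits.HubbardSuperconductivity.HubbardSuperconductivity.Theorems.KLProgrammeKLRegimeSplitTwoLegSizesMSChainFramesF
import Summits.HubbardSuperconductivity.HubbardSuperconductivity.Theorems.KLProgrammeKLRegimeSplitTwoLegSizesMSChainStep
import Summits.HubbardSuperconductivity.HubbardSuperconductivity.Theorems.KLProgrammeKLRegimeSplitTwoLegSizesMSDiffProfileSizes
import Summits.HubbardSuperconductivity.HubbardSuperconductivity.Theorems.KLProgrammeKLRegimeSplitTwoLegSizesMSOfChain
import Summits.HubbardSuperconductivity.HubbardSuperconductivity.Theorems.KLProgrammeKLRegimeSplitTwoLegSizesMSChainTable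

/-!
# Route `KLProgramme`, crux K3 — gen-5 ENGINE child (stmt-…-19918, `stub_twoLeg_step`, clause `TwoLegSizesMST`), recipe (L)+(F):
# THE TERM TABLE FOR THE CHAIN-FAMILY PROFILES (`msProfileF`; (P4-c) step 4d, fix (a))

Seat hubbard-kl-k3c3-p1 (g3).  Centred angular sizes `msGsF` and means `msMeanF` of ALL profiles `msProfileF μ S d Kp n N m` (symbol
family `S k` at chain frame `msChain k`, k3c3-p2's fix (a)) from:
* `σ k l` — sizes of the increment symbol AT CHAIN FRAME `k` (`|evalM (S k)| ≤ σ k 0`, `‖Dˡ evalM (S k)‖ ≤ σ k l`, `1 ≤ l ≤ 5`, `k ≤ N − n`);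
* `ε m l` — sizes of the ONE-PIECE FRAME RESPONSE symbol `S k − S (k−1)` of slot `m = n + k` (`l ≤ 4` and sup; the engine's new export (b));
* `e m j` — any sizes of the high parts `highPart d (Kp m)` (`…MSPieceParts`), and the chain regime of `chain_curve_sizes`.
Base `m = n`: `bellCum (σ 0) msD j`; slot `m`: RESPONSE `bellCum (ε m) msD j` (`curveProfile_centred_sizes`) + TRANSPORT
`bellDiffCum (σ (k−1)) msD (msdD … (e m)) j` (`comp_sub_centred_sizes` + `chain_step_curve_diff`).  Definitions are bookkeeping only; proofs only.
-/

noncomputable section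

namespace Summit.HubbardSuperconductivity.HubbardSuperconductivity.Theorems.KLRegimeSplit

set_option linter.dupNamespace false -- summit = problem name (single-conjunct summit), D-0017
set_option maxSynthPendingDepth 4 -- nested operator-norm instances (symbol sizes up to order five), as in `…CompDiff`

open Real Finset Literature.MathematicalPhysics.QuantumLattice Literature.MathematicalPhysics.QuantumLattice.BandSectorCounting
open Summit.HubbardSuperconductivity.HubbardSuperconductivity.Theorems.DispersionFlow
open Summit.HubbardSuperconductivity.HubbardSuperconductivity.Theorems.PerturbedFermiCurve

/-! ## §1 The tables -/

/-- **THE TERM TABLE** `msGsF`: base `bellCum (σ 0)`; slot `m` (`k = m − n`): response `bellCum (ε m)` + transport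
`bellDiffCum (σ (k−1)) … (msdD … (e m))`; else `0`. -/
def msGsF (σ ε : ℕ → ℕ → ℝ) (A A₃ A₄ Dt : ℝ) (e : ℕ → ℕ → ℝ) (n N m j : ℕ) : ℝ :=
  if m = n then bellCum (σ 0) (msD A₃ A₄) j
  else if m ∈ Ioc n N then
    bellCum (ε m) (msD A₃ A₄) j + bellDiffCum (σ (m - n - 1)) (msD A₃ A₄) (msdD A A₃ A₄ Dt (e m)) j
  else 0

/-- **THE MEAN TABLE** `msMeanF`: `σ 0 0` for the base, `ε m 0 + σ (k−1) 1 · msdD 0 (e m)` for slot `m`, else `0`. -/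
def msMeanF (σ ε : ℕ → ℕ → ℝ) (A A₃ A₄ Dt : ℝ) (e : ℕ → ℕ → ℝ) (n N m : ℕ) : ℝ :=
  if m = n then σ 0 0
  else if m ∈ Ioc n N then ε m 0 + σ (m - n - 1) 1 * msdD A A₃ A₄ Dt (e m) 0 else 0

/-! ## §2 Centring is subadditive -/

/-- `‖Dⁱ((f+g) − mean(f+g))‖ ≤ ‖Dⁱ(f − mean f)‖ + ‖Dⁱ(g − mean g)‖` for `Cⁱ` interval-integrable profiles. -/
theorem norm_iteratedFDeriv_centred_add_le {f g : ℝ → ℝ} {i : ℕ} (hf : ContDiff ℝ i f) (hg : ContDiff ℝ i g)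
    (hfi : IntervalIntegrable f MeasureTheory.volume 0 (2 * π)) (hgi : IntervalIntegrable g MeasureTheory.volume 0 (2 * π)) (t : ℝ) :
    ‖iteratedFDeriv ℝ i (fun t => (f t + g t) - klAngularMean (fun t => f t + g t)) t‖ ≤
      ‖iteratedFDeriv ℝ i (fun t => f t - klAngularMean f) t‖ + ‖iteratedFDeriv ℝ i (fun t => g t - klAngularMean g) t‖ := by
  have e : (fun t => (f t + g t) - klAngularMean (fun t => f t + g t)) =
      (fun t => f t - klAngularMean f) + fun t => g t - klAngularMean g := by
    funext t; simp only [Pi.add_apply, klAngularMean_add hfi hgi]; ring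
  rw [e, iteratedFDeriv_add_apply (hf.sub contDiff_const).contDiffAt (hg.sub contDiff_const).contDiffAt]
  exact norm_add_le _ _

/-! ## §3 The sizes -/

section Table

variable (d : ℕ) {Kp : ℕ → TrigPolyC4v} {n N : ℕ} (hnN : n ≤ N) {a : ℕ → ℕ → ℝ}
  (ha : ∀ m ≤ N, ∀ j ≤ 4, ∀ q : Momentum, ‖iteratedFDeriv ℝ j (evalM (Kp m)) q‖ ≤ a m j)

include hnN ha in
/-- **CENTRED ANGULAR SIZES OF ALL CHAIN-FAMILY PROFILES.**  See the module docstring. -/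
theorem msProfileF_centred_sizes {A : ℝ} (hA : ∀ j ≤ 2, chainSizeSum Kp a n N j ≤ A) (hA20 : A ≤ 1 / 20)
    (hd : klCurveD ≤ (bandBounds (show (-4 : ℝ) < -1.1 by norm_num) (show (-1.1 : ℝ) ≤ -0.1 by norm_num)
      (show (-0.1 : ℝ) < 0 by norm_num)).Dtmin - 2 * A)
    {μ : ℝ} (hlo : (-1.1 : ℝ) ≤ μ - A) (hhi : μ + A ≤ -0.1)
    {A₃ A₄ : ℝ} (hA₃ : chainSizeSum Kp a n N 3 ≤ A₃) (hA₄ : chainSizeSum Kp a n N 4 ≤ A₄)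
    (S : ℕ → TrigPolyC4v) {σ : ℕ → ℕ → ℝ} (hσnn : ∀ k l, 0 ≤ σ k l) (hσ0 : ∀ k ≤ N - n, ∀ q : Momentum, |evalM (S k) q| ≤ σ k 0)
    (hσ : ∀ k ≤ N - n, ∀ l, 1 ≤ l → l ≤ 5 → ∀ q : Momentum, ‖iteratedFDeriv ℝ l (evalM (S k)) q‖ ≤ σ k l)
    {ε : ℕ → ℕ → ℝ} (hεnn : ∀ m l, 0 ≤ ε m l)
    (hε0 : ∀ m ∈ Ioc n N, ∀ q : Momentum, |evalM (fsub (S (m - n)) (S (m - n - 1))) q| ≤ ε m 0)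
    (hε : ∀ m ∈ Ioc n N, ∀ l, 1 ≤ l → l ≤ 4 → ∀ q : Momentum,
      ‖iteratedFDeriv ℝ l (evalM (fsub (S (m - n)) (S (m - n - 1)))) q‖ ≤ ε m l)
    {e : ℕ → ℕ → ℝ} (he : ∀ m ∈ Ioc n N, ∀ j ≤ 4, ∀ q : Momentum, ‖iteratedFDeriv ℝ j (evalM (highPart d (Kp m))) q‖ ≤ e m j)
    (m : ℕ) {j : ℕ} (hj : j ≤ 4) {i : ℕ} (hi : i ≤ j) (t : ℝ) :
    ‖iteratedFDeriv ℝ i (fun t => msProfileF μ S d Kp n N m t - klAngularMean (msProfileF μ S d Kp n N m)) t‖ ≤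
      msGsF σ ε A A₃ A₄ ((bandBounds (show (-4 : ℝ) < -1.1 by norm_num) (show (-1.1 : ℝ) ≤ -0.1 by norm_num)
        (show (-0.1 : ℝ) < 0 by norm_num)).Dtmin) e n N m j := by
  set B := bandBounds (show (-4 : ℝ) < -1.1 by norm_num) (show (-1.1 : ℝ) ≤ -0.1 by norm_num) (show (-0.1 : ℝ) < 0 by norm_num)
    with hBdef
  -- the common curve tower, in the `iteratedDeriv` key, for every chain frame
  have hDk : ∀ k ≤ N - n, ∀ i, 1 ≤ i → i ≤ 4 → ∀ θ,
      ‖iteratedDeriv i (fun θ : ℝ => (WithLp.toLp 2 (klFermiPoint μ (msChain d Kp n N k) θ) : Momentum)) θ‖ ≤ msD A₃ A₄ i := by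
    intro k hk i hi1 hi4 θ
    obtain ⟨-, -, d1, d2, d3, d4⟩ := chain_curve_sizes d hnN ha hA hA20 hd hlo hhi hA₃ hA₄ hk θ
    rw [← norm_iteratedFDeriv_eq_norm_iteratedDeriv]
    interval_cases i
    · exact d1
    · exact d2
    · exact d3
    · exact d4
  have hCk : ∀ k ≤ N - n, ContDiff ℝ 4 (fun θ : ℝ => (WithLp.toLp 2 (klFermiPoint μ (msChain d Kp n N k) θ) : Momentum)) :=
    fun k hk => (chain_curve_sizes d hnN ha hA hA20 hd hlo hhi hA₃ hA₄ hk 0).1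
  have hCk' : ∀ k ≤ N - n, ContDiff ℝ 4 (klFermiPoint μ (msChain d Kp n N k)) :=
    fun k hk => (chain_curve_sizes d hnN ha hA hA20 hd hlo hhi hA₃ hA₄ hk 0).2.1
  have hDnn : ∀ i, 0 ≤ msD A₃ A₄ i := by
    intro i
    rcases i with _ | _ | _ | _ | _ | i
    · simp [msD]
    · exact (norm_nonneg _).trans (hDk 0 (by omega) 1 le_rfl (by norm_num) 0)
    · exact (norm_nonneg _).trans (hDk 0 (by omega) 2 (by norm_num) (by norm_num) 0)
    · exact (norm_nonneg _).trans (hDk 0 (by omega) 3 (by norm_num) (by norm_num) 0)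
    · exact (norm_nonneg _).trans (hDk 0 (by omega) 4 (by norm_num) (by norm_num) 0)
    · simp [msD]
  by_cases hm : m = n
  · -- the base profile
    subst hm
    rw [msProfileF_base, msGsF, if_pos rfl]
    exact curveProfile_centred_sizes μ (S 0) (msChain d Kp m N 0) (hCk 0 (by omega)) (hσnn 0) hDnn (hσ0 0 (by omega))
      (fun k hk1 hk4 q => hσ 0 (by omega) k hk1 (by omega) q) (hDk 0 (by omega)) hj hi t
  by_cases hmem : m ∈ Ioc n N
  · -- a slot profile: response + transport
    set k := m - n with hkdef
    have hk1 : 1 ≤ k := by have := (Finset.mem_Ioc.mp hmem).1; omega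
    have hk : k ≤ N - n := by have := (Finset.mem_Ioc.mp hmem).2; omega
    have hmk : m = n + k := by have := (Finset.mem_Ioc.mp hmem).1; omega
    have hp : msProfileF μ S d Kp n N m = fun θ =>
        curveProfile μ (fsub (S k) (S (k - 1))) (msChain d Kp n N k) θ +
          (evalM (S (k - 1)) (WithLp.toLp 2 (klFermiPoint μ (msChain d Kp n N k) θ)) -
            evalM (S (k - 1)) (WithLp.toLp 2 (klFermiPoint μ (msChain d Kp n N (k - 1)) θ))) := by
      funext θ
      rw [msProfileF_slot μ S d Kp hmem θ, ← hkdef, curveProfile_apply μ (S (k - 1)), curveProfile_apply μ (S (k - 1))]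
    rw [hp, msGsF, if_neg hm, if_pos hmem]
    have hfc : ContDiff ℝ 4 (curveProfile μ (fsub (S k) (S (k - 1))) (msChain d Kp n N k)) :=
      contDiff_curveProfile μ _ _ (hCk' k hk)
    have hgc : ContDiff ℝ 4 (fun θ => evalM (S (k - 1)) (WithLp.toLp 2 (klFermiPoint μ (msChain d Kp n N k) θ)) -
        evalM (S (k - 1)) (WithLp.toLp 2 (klFermiPoint μ (msChain d Kp n N (k - 1)) θ))) :=
      ((contDiff_evalM (S (k - 1))).comp (hCk k hk)).sub ((contDiff_evalM (S (k - 1))).comp (hCk (k - 1) (by omega)))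
    have hi4 : i ≤ 4 := hi.trans hj
    refine (norm_iteratedFDeriv_centred_add_le (hfc.of_le (by exact_mod_cast hi4)) (hgc.of_le (by exact_mod_cast hi4))
      (hfc.continuous.intervalIntegrable _ _) (hgc.continuous.intervalIntegrable _ _) t).trans (add_le_add ?_ ?_)
    · -- response term
      exact curveProfile_centred_sizes μ (fsub (S k) (S (k - 1))) (msChain d Kp n N k) (hCk k hk) (hεnn m) hDnn (hε0 m hmem)
        (fun l hl1 hl4 q => hε m hmem l hl1 hl4 q) (hDk k hk) hj hi t
    · -- transport term
      have he' : ∀ j ≤ 4, ∀ q : Momentum, ‖iteratedFDeriv ℝ j (evalM (highPart d (Kp (n + k)))) q‖ ≤ e m j := by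
        rw [← hmk]; exact he m hmem
      have hstep := chain_step_curve_diff d hnN ha hA hA20 hd hlo hhi hA₃ hA₄ hk1 hk he'
      have hdDnn : ∀ i, 0 ≤ msdD A A₃ A₄ B.Dtmin (e m) i := by
        intro i
        rcases i with _ | _ | _ | _ | _ | i
        · exact (norm_nonneg _).trans (hstep 0).1
        · exact (norm_nonneg _).trans ((hstep 0).2 1 le_rfl (by norm_num))
        · exact (norm_nonneg _).trans ((hstep 0).2 2 (by norm_num) (by norm_num))
        · exact (norm_nonneg _).trans ((hstep 0).2 3 (by norm_num) (by norm_num))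
        · exact (norm_nonneg _).trans ((hstep 0).2 4 (by norm_num) (by norm_num))
        · rw [msdD_add_five]; exact (norm_nonneg _).trans ((hstep 0).2 4 (by norm_num) (by norm_num))
      exact comp_sub_centred_sizes (F := evalM (S (k - 1))) (contDiff_evalM (S (k - 1))) (hCk (k - 1) (by omega)) (hCk k hk)
        (hσnn (k - 1)) hDnn hdDnn (fun l hl1 hl5 q => hσ (k - 1) (by omega) l hl1 hl5 q)
        (hDk (k - 1) (by omega)) (hDk k hk) (fun θ => (hstep θ).1) (fun i hi1 hi4 θ => (hstep θ).2 i hi1 hi4) hj hi t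
  · -- no profile
    rw [msProfileF_of_not_mem hm hmem, msGsF, if_neg hm, if_neg hmem, klAngularMean_zero]
    simp

include hnN ha in
/-- **MEANS OF ALL CHAIN-FAMILY PROFILES** (the `j = 0` constant entries of the fits). -/
theorem abs_klAngularMean_msProfileF_le {A : ℝ} (hA : ∀ j ≤ 2, chainSizeSum Kp a n N j ≤ A) (hA20 : A ≤ 1 / 20)
    (hd : klCurveD ≤ (bandBounds (show (-4 : ℝ) < -1.1 by norm_num) (show (-1.1 : ℝ) ≤ -0.1 by norm_num)
      (show (-0.1 : ℝ) < 0 by norm_num)).Dtmin - 2 * A)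
    {μ : ℝ} (hlo : (-1.1 : ℝ) ≤ μ - A) (hhi : μ + A ≤ -0.1)
    {A₃ A₄ : ℝ} (hA₃ : chainSizeSum Kp a n N 3 ≤ A₃) (hA₄ : chainSizeSum Kp a n N 4 ≤ A₄)
    (S : ℕ → TrigPolyC4v) {σ : ℕ → ℕ → ℝ} (hσnn : ∀ k l, 0 ≤ σ k l) (hσ0 : ∀ k ≤ N - n, ∀ q : Momentum, |evalM (S k) q| ≤ σ k 0)
    (hσ : ∀ k ≤ N - n, ∀ l, 1 ≤ l → l ≤ 5 → ∀ q : Momentum, ‖iteratedFDeriv ℝ l (evalM (S k)) q‖ ≤ σ k l)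
    {ε : ℕ → ℕ → ℝ} (hε0 : ∀ m ∈ Ioc n N, ∀ q : Momentum, |evalM (fsub (S (m - n)) (S (m - n - 1))) q| ≤ ε m 0)
    {e : ℕ → ℕ → ℝ} (he : ∀ m ∈ Ioc n N, ∀ j ≤ 4, ∀ q : Momentum, ‖iteratedFDeriv ℝ j (evalM (highPart d (Kp m))) q‖ ≤ e m j)
    (m : ℕ) :
    |klAngularMean (msProfileF μ S d Kp n N m)| ≤
      msMeanF σ ε A A₃ A₄ ((bandBounds (show (-4 : ℝ) < -1.1 by norm_num) (show (-1.1 : ℝ) ≤ -0.1 by norm_num)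
        (show (-0.1 : ℝ) < 0 by norm_num)).Dtmin) e n N m := by
  by_cases hm : m = n
  · subst hm
    rw [msMeanF, if_pos rfl, msProfileF_base]
    refine abs_klAngularMean_le' fun θ => ?_
    rw [curveProfile_apply]
    exact hσ0 0 (by omega) _
  by_cases hmem : m ∈ Ioc n N
  · set k := m - n with hkdef
    have hk1 : 1 ≤ k := by have := (Finset.mem_Ioc.mp hmem).1; omega
    have hk : k ≤ N - n := by have := (Finset.mem_Ioc.mp hmem).2; omega
    have hmk : m = n + k := by have := (Finset.mem_Ioc.mp hmem).1; omega
    rw [msMeanF, if_neg hm, if_pos hmem]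
    have he' : ∀ j ≤ 4, ∀ q : Momentum, ‖iteratedFDeriv ℝ j (evalM (highPart d (Kp (n + k)))) q‖ ≤ e m j := by
      rw [← hmk]; exact he m hmem
    have hstep := chain_step_curve_diff d hnN ha hA hA20 hd hlo hhi hA₃ hA₄ hk1 hk he'
    have hM₁ : ∀ z : Momentum, ‖fderiv ℝ (evalM (S (k - 1))) z‖ ≤ σ (k - 1) 1 := fun z => by
      rw [norm_fderiv_eq_norm_iteratedFDeriv_one]; exact hσ (k - 1) (by omega) 1 le_rfl (by norm_num) z
    refine abs_klAngularMean_le' fun θ => ?_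
    rw [msProfileF_slot μ S d Kp hmem θ]
    refine (abs_add_le _ _).trans (add_le_add ?_ ?_)
    · rw [curveProfile_apply]; exact hε0 m hmem _
    · rw [curveProfile_apply, curveProfile_apply]
      have h := (convex_univ).norm_image_sub_le_of_norm_fderiv_le (𝕜 := ℝ) (f := evalM (S (k - 1)))
        (fun z _ => ((contDiff_evalM (S (k - 1)) (k := 1)).differentiable one_ne_zero) z) (fun z _ => hM₁ z)
        (Set.mem_univ (WithLp.toLp 2 (klFermiPoint μ (msChain d Kp n N (k - 1)) θ) : Momentum))
        (Set.mem_univ (WithLp.toLp 2 (klFermiPoint μ (msChain d Kp n N k) θ) : Momentum))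
      rw [Real.norm_eq_abs] at h
      exact h.trans (mul_le_mul_of_nonneg_left (hstep θ).1 (hσnn (k - 1) 1))
  · rw [msProfileF_of_not_mem hm hmem, msMeanF, if_neg hm, if_neg hmem, klAngularMean_zero, abs_zero]

end Table

end Summit.HubbardSuperconductivity.HubbardSuperconductivity.Theorems.KLRegimeSplit

end
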